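import Literature.MathematicalPhysics.QuantumFieldTheory.Balaban1983to89.B15Claim129Assembly
import Literature.MathematicalPhysics.QuantumFieldTheory.Balaban1983to89.B15Eq13Concrete
import Literature.MathematicalPhysics.QuantumFieldTheory.Balaban1983to89.B15Sect1Instances

/-!
# `Balaban1983to89.B15Claim129AtInstances` — T. Bałaban, *Large field renormalization. I. The basic step of the 𝐑 operation*,
# Commun. Math. Phys. **122** (1989) 175–202 [Balaban1989LargeFieldI] = «[IV]», (1.29) p. 183: p29's lettered one-theorem
# assembly `B15Claim129Assembly.claim129_assembly` (p386619) AT PRINT'S OWN INSTANCES — the lettered data `Setting129` built from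
# r11's concrete functions (1.3)–(1.9) (`B15Eq13Concrete`, p386016) and instances (1.20)–(1.27) (`B15Sect1Instances`, p385406)

statement-level skeleton of published theorems with citation tags; proofs where landed; nothing here is a claim about
the Yang–Mills mass gap

PDF held: `paper:balaban1989-cmp122-large-field-i` (journal page = PDF page + 174); p. 183 [PDF 9] (the claim after (1.29)) and
pp. 184–187 (its proof) read on the text layer and on the ×2 renders
`run/shared/lean/pub/pub-balaban/b2b-balaban-ref1/pages/1989-cmp122-large-field-I/1989-cmp122-large-field-I-p009-x2.png` ff.

CITATION HEADER / WHAT IS REPRODUCED (mega-formalization `lit-balaban`, HOME `run/shared/lean/pub/lit-balaban/`; unit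
`lit-balaban-r11` gen 110, PROXY CONSTITUENT for block B15 under the lead's ruling G.5-61).  The junction below was WRITTEN by the
DEFINITIONS steward r20 gen 69 as the scratch twin `Junction129Twin.lean` (`lit-balaban-r20/tools/g69/scratch/`, hub `lean check`
rc 0 with the three members' definitions copied because their oleans were unbuilt) and is filed here, with imports instead of copies,
as the HONEST SCOPE (ii) junction that p29's `B15Claim129Assembly` names (*"r11's `B15Sect1Instances` ∕ p29's
`B15Sect1ChartInstances` give print's instances of `U^{(n)}_{k,Z}`, `V_Z^{(j)}`, `χ′_j`; none of these constructions is needed for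
the implication"*).  SKELETON row served (cells only; the CLAIM head of B15.Eq1.29 stays `typed` per the lead g18 word
2026-08-24T23:15:05Z): **B15.Eq1.29**.

THE PRINT (p. 183, after (1.29)): *"the restrictions introduced by the new characteristic functions imply that the functions
(1.3), (1.4), (1.5), (1.7), (1.8), χ_k^{(n)} are equal to 1"*.

WHAT IS PROVED (one `def` WITH BODY + 5 theorems; 0 `def … : Prop` facts, 0 `sorry`, standard axioms).
§1 **`setting129Std`** — PRINT'S OWN INSTANCE of p29's lettered data `Setting129`: configuration space `C := MSField P G ×
   VecField P j 𝔤` (the pair `(V, A_j)` of integration variables); `U^{(n)}_{k,Z} := bgNZstd … (j − h) V` ((1.20), level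
   `n = j − h`), `U^{(n+1)}_{k,Z} := bgNZstd … (j + 1 − h) V`; `U_{j,□}(V_j) := ukBox bg M₁ □^{∼4} j V_j`, `U_{j+1,□′}(V_{j+1})`
   likewise ([III] (2.16)); `V_j(y,x) := cd.holTo V_j y x` ([I] (0.11)); the (1.27) bond set `(Ω^c_{j+1}∖Z″_{j+1})^{(j)*} :=
   bondsOf (pts j …)` and `V_Z^{(j)} := vZstd … V j` ((1.26)); `(□′^{∼2})* := D3.bondsStar □′`, `V^{(j)}_{□′} := Vbox (sect3Of …) □′
   V_{j+1}` ([III] (3.4)), `V^{(j)}_{Z_{j+1}∖Z_j} := vSeam18 … V` ((1.33) at print's pins, row Eq1.33 itself untouched); `L := P.L`,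
   `η := P.eta k`, `g_j`, `δ_j`, `δ′_j`.
§2 **`old129_iff`** — the OLD functions of (1.29) at these instances ARE r11's concrete (1.3), (1.4), (1.5), (1.7), (1.8) `= 1` and
   `χ_k^{(n)}` at `U^{(n)}_{k,Z}(V)` (by the `…_eq_one_iff` criteria of `B15Eq13Concrete`); **`new129_iff`** — the NEW restrictions ARE
   `χ_k^{(n+1)}` at `U^{(n+1)}_{k,Z}(V)`, r11's concrete (1.9)-product `= 1` and (1.27) `chi127std`; `chi124_level_iff` — the
   `χ_k^{(n)}` conjunct IS `chi124std` at level `n = j − h`.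
§3 **`eq129_at_instances`** — (1.29) AT PRINT'S INSTANCES: from the kernel implication `Claim129 (new129 D) (old129 χ D)` at
   `D := setting129Std …`, for a pair `(V, A_j)` obeying the three new restrictions the six concrete functions of r11 are `= 1` ∕
   hold (`h ≦ j`, `j + 1 ≦ k`); **`claim129_std`** — that implication itself AT THE INSTANCES, i.e. p29's `claim129_assembly`
   specialised to `setting129Std`: every lettered object in its printed-leaf hypotheses ((1.30)–(1.31)+[III] (3.6)–(3.8), (3.9) [III]
   + *"O(1)δ′_j < ε_j"*, (1.35)∕(1.40) with (1.37)–(1.39)∕(1.42), the (1.48) chain; print's numerics) is now print's own object.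
HONEST SCOPE.  Bookkeeping only: no analytic leaf is proved here — the leaves stay hypotheses exactly as in p386619 (whence the CLAIM
head of row B15.Eq1.29 stays `typed`); case `j + 1 = k` of (1.29) and the undisplayed first case `j ≦ k₀` of (1.24) stay outside
exactly as in p386619.
-/

noncomputable section

namespace Literature.MathematicalPhysics.QuantumFieldTheory.Balaban1983to89.B15Claim129AtInstances

open Literature.MathematicalPhysics.QuantumFieldTheory.Balaban1983to89
open B15DeterminingSets B14.Eq213DetSet B14.Eq216Concrete B14.Sect3Decomp B15.PrelimIntegrations B15StandardRep GaugeField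
open B15.BasicStep B15Chi124DetSets B15Claim129Step B15SmallField185 B8Eq17ClassAkV1
open B15Eq13Concrete B15Sect1Instances B15Claim129Assembly
open Literature.MathematicalPhysics.QuantumFieldTheory.BalabanImbrieJaffe1984to88.BIJ85Eq453GaugeField
open Set
open scoped BigOperators

variable {P : Params}
variable {G : Type*} [GaugeGroup G] {av : ∀ j, Averaging P j G} (bg : DetBackground P G av) (M₁ : ℕ)

variable {𝔤 : Type*} [NormedAddCommGroup 𝔤] [NormedSpace ℝ 𝔤] (χ : LieChart G 𝔤)
variable {j : ℕ} (D3 : Sect3Data P G j) (enl4' : D3.Cube1 → Set (Site P 0))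
variable {ι : Type*} (plaqT : ι → Set (Plaq P 0)) (enl4 : ι → Set (Site P 0)) (cd : ContourData P j G)
variable (Ω Zpp Zseq : ℕ → Set (Site P 0)) (Z : Set (Site P 0)) (h k₀ k : ℕ) (β L₀ : ℝ) (ε g δ δ' : ℕ → ℝ)
variable (X13 : Finset ι) (X14 X7 X8 X9 : Finset D3.Cube1) (S : Finset (Site P (j + 1) × Site P j))

/-- PRINT'S INSTANCE of the lettered data of (1.29): configuration space `C := MSField P G × VecField P j 𝔤` (the pair
`(V, A_j)` of integration variables); `U^{(n)}_{k,Z} := bgNZstd … (j − h) V` ((1.20), level `n = j − h`), `U^{(n+1)}_{k,Z} :=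
bgNZstd … (j + 1 − h) V`; `U_{j,□}(V_j) := ukBox bg M₁ □^{∼4} j V_j`, `U_{j+1,□′}(V_{j+1})` likewise ([III] (2.16)); `V_j(y,x) :=
cd.holTo V_j y x` ([I] (0.11)); the (1.27) bond set `(Ω^c_{j+1}∖Z″_{j+1})^{(j)*} := bondsOf (pts j …)` and `V_Z^{(j)} := vZstd … V j`
((1.26)); `(□′^{∼2})* := D3.bondsStar □′`, `V^{(j)}_{□′} := Vbox (sect3Of …) □′ V_{j+1}` ([III] (3.4)), `V^{(j)}_{Z_{j+1}∖Z_j} :=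
vSeam18 … V` ((1.33) at print's pins); `L := P.L`, `η := P.eta k`, `g_j := g j`, `δ_j := δ j`, `δ′_j := δ′ j`. [cite: Balaban1989LargeFieldI, (1.29) p.183; (1.20)–(1.27) pp.180–182] -/
def setting129Std : Setting129 P G 𝔤 (MSField P G × VecField P j 𝔤) ι D3.Cube1 j where
  Ω := Ω
  Zpp := Zpp
  h := h
  k₀ := k₀
  k := k
  β := β
  L₀ := L₀
  L := (P.L : ℝ)
  η := P.eta k
  ε := ε
  gj := g j
  δj := δ j
  δ'j := δ' j
  UnZ := fun U => bgNZstd bg M₁ Ω Zpp Z h k (j - h) U.1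
  Un1Z := fun U => bgNZstd bg M₁ Ω Zpp Z h k (j + 1 - h) U.1
  plaqT := plaqT
  cubes13 := ↑X13
  Ubox13 := fun U c => ukBox bg M₁ (enl4 c) j (U.1 j)
  plaqT' := D3.plaqT
  cubes14 := ↑X14
  Ubox14 := fun U c => ukBox bg M₁ (enl4' c) (j + 1) (U.1 (j + 1))
  S15 := ↑S
  V15 := fun U yx => cd.holTo (U.1 j) yx.1 yx.2
  S27 := bondsOf (pts j ((Ω (j + 1))ᶜ \ Zpp (j + 1)))
  Vj := fun U => U.1 j
  VZ := fun U => vZstd bg M₁ Ω Zpp Z h k U.1 j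
  bondsStar := fun c => ↑(D3.bondsStar c)
  cubes7 := ↑X7
  cubes8 := ↑X8
  cubes9 := ↑X9
  Vbox := fun U c => Vbox (sect3Of bg M₁ D3 enl4') av c (U.1 (j + 1))
  Vseam := fun U => vSeam18 bg M₁ Ω Zseq U.1
  Aj := fun U => U.2

/-- **JUNCTION 1 — the OLD functions of (1.29) at print's instances ARE r11's concrete (1.3), (1.4), (1.5), (1.7), (1.8)
`= 1` and `χ_k^{(n)}` at `U^{(n)}_{k,Z}(V)`** (`j + 1 ≤ k`). [cite: Balaban1989LargeFieldI, (1.29) p.183; (1.3)–(1.8) p.178] -/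
theorem old129_iff (hjk : j + 1 ≤ k) (U : MSField P G × VecField P j 𝔤) :
    old129 χ (setting129Std bg M₁ D3 enl4' plaqT enl4 cd Ω Zpp Zseq Z h k₀ k β L₀ ε g δ δ' X13 X14 X7 X8 X9 S) U ↔
      chi13 bg M₁ X13 plaqT enl4 ε j U.1 = 1 ∧
      chi14 bg M₁ X14 D3.plaqT enl4' ε j U.1 = 1 ∧
      chi15 cd S (ε j) (U.1 j) = 1 ∧
      chi17 bg M₁ D3 enl4' δ X7 U.1 = 1 ∧
      chi18std bg M₁ D3 enl4' χ g δ X8 Ω Zseq U.2 U.1 = 1 ∧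
      Chi124 Ω Zpp h k₀ j k β L₀ ε (P.L : ℝ) (P.eta k) (bgNZstd bg M₁ Ω Zpp Z h k (j - h) U.1) := by
  rw [chi13_eq_one_iff bg M₁ (Nat.le_of_succ_le hjk), chi14_eq_one_iff bg M₁ hjk, chi15_eq_one_iff, chi17_eq_one_iff,
    chi18std, chi18_eq_one_iff]
  exact Iff.rfl

omit [NormedSpace ℝ 𝔤] in
/-- **JUNCTION 2 — the NEW restrictions of (1.29) at print's instances ARE `χ_k^{(n+1)}` at `U^{(n+1)}_{k,Z}(V)`, r11's concrete
(1.9)-product `= 1`, and r11's concrete (1.27) `chi127std`.** [cite: Balaban1989LargeFieldI, (1.29) p.183; (1.9) p.178, (1.27) p.182] -/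
theorem new129_iff (U : MSField P G × VecField P j 𝔤) :
    new129 (setting129Std bg M₁ D3 enl4' plaqT enl4 cd Ω Zpp Zseq Z h k₀ k β L₀ ε g δ δ' X13 X14 X7 X8 X9 S) U ↔
      Chi124 Ω Zpp h k₀ (j + 1) k β L₀ ε (P.L : ℝ) (P.eta k) (bgNZstd bg M₁ Ω Zpp Z h k (j + 1 - h) U.1) ∧
      chi19 D3 g δ X9 U.2 = 1 ∧
      chi127std bg M₁ Ω Zpp Z h k (δ' j) U.1 j := by
  rw [chi19_eq_one_iff]
  exact Iff.rfl

/-- The `χ_k^{(n)}` conjunct IS r11's `chi124std` at level `n = j − h` (`h ≤ j`). [cite: Balaban1989LargeFieldI, (1.24) pp.181–182] -/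
theorem chi124_level_iff (hhj : h ≤ j) (V : MSField P G) :
    Chi124 Ω Zpp h k₀ j k β L₀ ε (P.L : ℝ) (P.eta k) (bgNZstd bg M₁ Ω Zpp Z h k (j - h) V) ↔
      chi124std bg M₁ Ω Zpp Z h k k₀ (j - h) β L₀ ε (P.L : ℝ) (P.eta k) V := by
  have e : h + (j - h) = j := by omega
  simp only [chi124std, e]

/-- **(1.29) AT PRINT'S INSTANCES** — *"the restrictions introduced by the new characteristic functions imply that the functions
(1.3), (1.4), (1.5), (1.7), (1.8), χ_k^{(n)} are equal to 1"*: from p29's kernel implication `Claim129 (new129 D) (old129 χ D)` at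
`D := setting129Std …`, for a pair `(V, A_j)` with `χ_k^{(n+1)}(U^{(n+1)}_{k,Z}(V))`, `Π χ^{(j)}_{□′}(A_j) = 1`, `χ′_j(V) `, the six
concrete functions of r11 are `= 1` ∕ hold (`h ≤ j`, `j + 1 ≤ k`). [cite: Balaban1989LargeFieldI, (1.29) p.183, pp.184–187] -/
theorem eq129_at_instances (hhj : h ≤ j) (hjk : j + 1 ≤ k)
    (h129 : Claim129 (new129 (setting129Std bg M₁ D3 enl4' plaqT enl4 cd Ω Zpp Zseq Z h k₀ k β L₀ ε g δ δ' X13 X14 X7 X8 X9 S))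
      (old129 χ (setting129Std bg M₁ D3 enl4' plaqT enl4 cd Ω Zpp Zseq Z h k₀ k β L₀ ε g δ δ' X13 X14 X7 X8 X9 S)))
    (V : MSField P G) (Aj : VecField P j 𝔤)
    (hnew124 : chi124std bg M₁ Ω Zpp Z h k k₀ (j + 1 - h) β L₀ ε (P.L : ℝ) (P.eta k) V)
    (hnew19 : chi19 D3 g δ X9 Aj = 1) (hnew127 : chi127std bg M₁ Ω Zpp Z h k (δ' j) V j) :
    chi13 bg M₁ X13 plaqT enl4 ε j V = 1 ∧ chi14 bg M₁ X14 D3.plaqT enl4' ε j V = 1 ∧ chi15 cd S (ε j) (V j) = 1 ∧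
      chi17 bg M₁ D3 enl4' δ X7 V = 1 ∧ chi18std bg M₁ D3 enl4' χ g δ X8 Ω Zseq Aj V = 1 ∧
      chi124std bg M₁ Ω Zpp Z h k k₀ (j - h) β L₀ ε (P.L : ℝ) (P.eta k) V := by
  have e1 : h + (j + 1 - h) = j + 1 := by omega
  have hnew : new129 (setting129Std bg M₁ D3 enl4' plaqT enl4 cd Ω Zpp Zseq Z h k₀ k β L₀ ε g δ δ' X13 X14 X7 X8 X9 S) (V, Aj) := by
    rw [new129_iff]
    refine ⟨?_, hnew19, hnew127⟩
    simpa only [chi124std, e1] using hnew124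
  have hold := (old129_iff bg M₁ χ D3 enl4' plaqT enl4 cd Ω Zpp Zseq Z h k₀ k β L₀ ε g δ δ' X13 X14 X7 X8 X9 S hjk (V, Aj)).1
    (h129 _ hnew)
  rw [chi124_level_iff bg M₁ Ω Zpp Z h k₀ k β L₀ ε hhj] at hold
  exact hold

/-- **(1.29) AT PRINT'S INSTANCES FROM THE PRINTED LEAVES** — p29's `claim129_assembly` (p386619) specialised to `setting129Std`:
every lettered object of its hypotheses is now print's own (`U^{(n)}_{k,Z} = bgNZstd …`, `U_{j,□}(V_j) = ukBox …`, `V_j(y,x) =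
cd.holTo …`, `V_Z^{(j)} = vZstd …`, `V^{(j)}_{□′} = Vbox (sect3Of …) …`, `V^{(j)}_{Z_{j+1}∖Z_j} = vSeam18 …`, `A_j`), the
printed leaves ((1.30)–(1.31) + [III] (3.6)–(3.8) as `L131`/`L131'`, (3.9) [III] + *"O(1)δ′_j < ε_j"* as `L39`/`hC15`, (1.40) with
(1.42) as `L17`, (1.35)/(1.40) with (1.37)–(1.39)/(1.42) as `L18`, the (1.48) chain as `L148`) keep p29's printed form, and the
numerics are print's (`0 < β ≦ 1/2`, `α ≦ 1/8`, `β₀ ≦ 1/2`, `2 ≦ L`, `1 ≦ L₀ < L/2`, `ε_j(L^{k−j}η) ≦ L⁻²`, `ε_{j+1} ≦ (1+β₀)ε_j`,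
`δ′_j < ¾δ_j`, `g_j > 0`; scales `h ≦ k₀`, `k₀ + 2 ≦ j`, `j + 1 < k`).  Conclusion: `Claim129 (new129 D) (old129 χ D)` at
`D := setting129Std …`; with `old129_iff`/`new129_iff` (or `eq129_at_instances`) the six concrete functions of r11 are `= 1` ∕ hold
for every `(V, A_j)` obeying the three concrete new restrictions.  Nothing but `claim129_assembly` is used.
[cite: Balaban1989LargeFieldI, (1.29) p.183, pp.184–187] -/
theorem claim129_std (hk₀ : h ≤ k₀) (hj : k₀ + 2 ≤ j) (hjk : j + 1 < k) (hΩ : ∀ i, Ω (i + 1) ⊆ Ω i)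
    {α β₀ : ℝ} (hα0 : 0 ≤ α) (hα : α ≤ 1 / 8) (hβ0 : 0 < β) (hβ : β ≤ 1 / 2) (hβ₀0 : 0 ≤ β₀) (hβ₀ : β₀ ≤ 1 / 2)
    (hL2 : 2 ≤ (P.L : ℝ)) (hL₀1 : 1 ≤ L₀) (hL₀L : L₀ < (P.L : ℝ) / 2) (hη : 0 ≤ P.eta k) (hε : ∀ i, 0 ≤ ε i)
    (hε1 : ε j ≤ 1) (hε1' : ε (j + 1) ≤ 1) (hεξ : ε j * ((P.L : ℝ) ^ (k - j) * P.eta k) ≤ ((P.L : ℝ) ^ 2)⁻¹)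
    (hεξ' : ε (j + 1) * ((P.L : ℝ) ^ (k - (j + 1)) * P.eta k) ≤ ((P.L : ℝ) ^ 2)⁻¹) (hflow : ε (j + 1) ≤ (1 + β₀) * ε j)
    (hg : 0 < g j) (hδ : δ' j < 3 / 4 * δ j) (hchart : ∀ X : 𝔤, dist1 (χ.expI X) ≤ ‖X‖)
    (hS89 : ∀ c ∈ (↑X8 : Set D3.Cube1), (↑(D3.bondsStar c) : Set (PBond P j)) ⊆
      ⋃ c' ∈ (↑X9 : Set D3.Cube1), (↑(D3.bondsStar c') : Set (PBond P j)))
    -- the printed leaves AT THE INSTANCES, for the pairs `(V, A_j)` obeying the new restrictions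
    (L131 : ∀ U : MSField P G × VecField P j 𝔤, new129 (setting129Std bg M₁ D3 enl4' plaqT enl4 cd Ω Zpp Zseq Z h k₀ k β L₀ ε g δ δ' X13 X14 X7 X8 X9 S) U →
      Chi124 Ω Zpp h k₀ j k β L₀ ε (P.L : ℝ) (P.eta k) (bgNZstd bg M₁ Ω Zpp Z h k (j - h) U.1) →
      ∀ c ∈ (↑X13 : Set ι), ∀ p ∈ plaqT c,
        dist1 (plaqHol (ukBox bg M₁ (enl4 c) j (U.1 j)) p) < expr131a β (ε j) ((P.L : ℝ) ^ (k - j) * P.eta k))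
    (L131' : ∀ U : MSField P G × VecField P j 𝔤, new129 (setting129Std bg M₁ D3 enl4' plaqT enl4 cd Ω Zpp Zseq Z h k₀ k β L₀ ε g δ δ' X13 X14 X7 X8 X9 S) U →
      ∀ c ∈ (↑X14 : Set D3.Cube1), ∀ p ∈ D3.plaqT c,
        dist1 (plaqHol (ukBox bg M₁ (enl4' c) (j + 1) (U.1 (j + 1))) p) <
          expr131a β (ε (j + 1)) ((P.L : ℝ) ^ (k - (j + 1)) * P.eta k))
    {C15 : ℝ} (hC15 : C15 * δ' j < ε j)
    (L39 : ∀ U : MSField P G × VecField P j 𝔤, new129 (setting129Std bg M₁ D3 enl4' plaqT enl4 cd Ω Zpp Zseq Z h k₀ k β L₀ ε g δ δ' X13 X14 X7 X8 X9 S) U →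
      ∀ yx ∈ (↑S : Set (Site P (j + 1) × Site P j)), dist1 (cd.holTo (U.1 j) yx.1 yx.2) ≤ C15 * δ' j)
    (L17 : ∀ U : MSField P G × VecField P j 𝔤, new129 (setting129Std bg M₁ D3 enl4' plaqT enl4 cd Ω Zpp Zseq Z h k₀ k β L₀ ε g δ δ' X13 X14 X7 X8 X9 S) U → ∀ c ∈ (↑X7 : Set D3.Cube1),
      (↑(D3.bondsStar c) : Set (PBond P j)) ⊆ bondsOf (pts j ((Ω (j + 1))ᶜ \ Zpp (j + 1))) ∧
      ∃ (Mt MjUn1 : GaugeField P j G) (ubR : GaugeTransf P j G) (Hbox : VecField P j 𝔤),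
        Rep140 χ Mt MjUn1 (vZstd bg M₁ Ω Zpp Z h k U.1 j) (Vbox (sect3Of bg M₁ D3 enl4') av c (U.1 (j + 1))) ubR Hbox ∧
          ∀ b ∈ (↑(D3.bondsStar c) : Set (PBond P j)), dist1 (χ.expI (Hbox b)) < δ j / 2)
    (L18 : ∀ U : MSField P G × VecField P j 𝔤, new129 (setting129Std bg M₁ D3 enl4' plaqT enl4 cd Ω Zpp Zseq Z h k₀ k β L₀ ε g δ δ' X13 X14 X7 X8 X9 S) U → ∀ c ∈ (↑X8 : Set D3.Cube1),
      ∃ (Mt MjUn1 : GaugeField P j G) (ujR : GaugeTransf P j G) (Hj : VecField P j 𝔤)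
        (Mt' MjUn1' : GaugeField P j G) (ubR : GaugeTransf P j G) (Hbox : VecField P j 𝔤),
        Rep135 χ Mt MjUn1 (vZstd bg M₁ Ω Zpp Z h k U.1 j) (vSeam18 bg M₁ Ω Zseq U.1) ujR Hj ∧
          Rep140 χ Mt' MjUn1' (vZstd bg M₁ Ω Zpp Z h k U.1 j) (Vbox (sect3Of bg M₁ D3 enl4') av c (U.1 (j + 1))) ubR Hbox ∧
          (∀ b ∈ (↑(D3.bondsStar c) : Set (PBond P j)), dist1 (χ.expI (Hj b)) < δ j / 2) ∧
          (∀ b ∈ (↑(D3.bondsStar c) : Set (PBond P j)), dist1 (χ.expI (Hbox b)) < δ j / 2))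
    (L148 : ∀ U : MSField P G × VecField P j 𝔤, new129 (setting129Std bg M₁ D3 enl4' plaqT enl4 cd Ω Zpp Zseq Z h k₀ k β L₀ ε g δ δ' X13 X14 X7 X8 X9 S) U →
      (∀ i, h ≤ i → i < j → ∀ p ∈ plaqsOf (region149 Ω Zpp h i),
        Ineq148 (dist1 (plaqHol (bgNZstd bg M₁ Ω Zpp Z h k (j - h) U.1) p))
          (dist1 (plaqHol (bgNZstd bg M₁ Ω Zpp Z h k (j + 1 - h) U.1) p)) α β ((1 / 2 : ℝ) ^ (j - i))
          (E124 ε (P.L : ℝ) (P.eta k) k i)) ∧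
      (∀ p ∈ plaqsOf ((Ω (k₀ + 1))ᶜ \ Zpp (j + 1)),
        Ineq148 (dist1 (plaqHol (bgNZstd bg M₁ Ω Zpp Z h k (j - h) U.1) p))
          (dist1 (plaqHol (bgNZstd bg M₁ Ω Zpp Z h k (j + 1 - h) U.1) p)) α β 1 (E124 ε (P.L : ℝ) (P.eta k) k j)) ∧
      (∀ l, k₀ < l → l ≤ j → ∀ p ∈ plaqsOf (Ω l \ Ω (l + 1)),
        Ineq148 (dist1 (plaqHol (bgNZstd bg M₁ Ω Zpp Z h k (j - h) U.1) p))
          (dist1 (plaqHol (bgNZstd bg M₁ Ω Zpp Z h k (j + 1 - h) U.1) p)) α β 1 (E124 ε (P.L : ℝ) (P.eta k) k j)) ∧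
      (∀ p ∈ plaqsOf (Zpp (j + 1) \ Zpp j),
        Ineq148 (dist1 (plaqHol (bgNZstd bg M₁ Ω Zpp Z h k (j - h) U.1) p))
          (dist1 (plaqHol (bgNZstd bg M₁ Ω Zpp Z h k (j + 1 - h) U.1) p)) α β 1 (E124 ε (P.L : ℝ) (P.eta k) k j))) :
    Claim129 (new129 (setting129Std bg M₁ D3 enl4' plaqT enl4 cd Ω Zpp Zseq Z h k₀ k β L₀ ε g δ δ' X13 X14 X7 X8 X9 S)) (old129 χ (setting129Std bg M₁ D3 enl4' plaqT enl4 cd Ω Zpp Zseq Z h k₀ k β L₀ ε g δ δ' X13 X14 X7 X8 X9 S)) :=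
  claim129_assembly χ (setting129Std bg M₁ D3 enl4' plaqT enl4 cd Ω Zpp Zseq Z h k₀ k β L₀ ε g δ δ' X13 X14 X7 X8 X9 S) hk₀ hj hjk hΩ hα0 hα hβ0 hβ hβ₀0 hβ₀ hL2 hL₀1 hL₀L hη hε hε1 hε1' hεξ hεξ' hflow hg hδ hchart
    hS89 L131 L131' hC15 L39 L17 L18 L148

end Literature.MathematicalPhysics.QuantumFieldTheory.Balaban1983to89.B15Claim129AtInstances

end
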